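import Literature.AnabelianGeometry.SemiGraphs.TemperedEdgeLikeDistinctProofs
import Literature.AnabelianGeometry.SemiGraphs.TemperedThm37OfCompactInVerticialAt
import Literature.AnabelianGeometry.SemiGraphs.TemperedEdgeLikeProofs
import Literature.AnabelianGeometry.SemiGraphs.TemperedReconstructionReductionsProofs
import HarnessLib

/-!
# [SemiAnbd] Thm. 3.7 (iii)/(iv): the verticial HOST of an edge-like subgroup THROUGH A GIVEN BRANCH is unique

Mochizuki, *Semi-graphs of anabelioids*, Publ. RIMS **42** (2006), §3, Thm. 3.7 (ii)–(iv) pp. 40–41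
[cite: MochizukiSemiAnbd2006, Thm 3.7(iii) pp.40-41] ("`π₁^temp(𝒢_v) ∩ π₁^temp(𝒢_e)` … maximal compact subgroups
… precisely two"), §2 p. 23 (the image `Π_b ⊆ Π_v` of a branch).

PROOF-ONLY brick (abc-iut cell, layer L3, seat abc-iut-L3-t2 gen 5, row «Ex310-GRAPH-ACTION», part G′; no
definition, no instance, no new named fact).  An edge-like subgroup `M = g·φ(Π_b)·g⁻¹` of the edge `e` of a branch
`b` abutting to `v` (`φ` verticial at `v`) is HOSTED by the verticial subgroup `g·φ(Π_v)·g⁻¹` — "through the branch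
`b`".  For a loop `e` at `v` the same `M` is hosted at `v` through the other branch too, by a DIFFERENT verticial
subgroup; but THROUGH A FIXED BRANCH the host is unique:
* `host_eq_of_presentations_through_branch` — if `g·φ(Π_b)·g⁻¹ = g'·φ(Π_b)·g'⁻¹` then
  `g·φ(Π_v)·g⁻¹ = g'·φ(Π_v)·g'⁻¹` (family-of-verticial-homomorphisms form, as in `branch_eq_of_hosts_eq`);
* `host_eq_of_presentations_through_branch'` — the same for any one verticial `φ` at `v`.
Inputs, all in the tree BY NAME: Thm. 3.7 (iii) AT `𝒢` (`CompactInVerticialAt 𝒢`: a nontrivial compact subgroup in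
two distinct verticial subgroups lies in no third one and in an edge-like subgroup of a CLOSED edge), its consequence
`EdgeLikeDistinctAt` (`edgeLikeDistinctAt_of_compactInVerticialAt`), Thm. 3.7 (ii) (`VerticialDistinct`,
`verticialDistinct_holds`) and injectivity (`verticialInjective_holds`), LEMMA E (`branch_eq_of_hosts_eq`: one host
through two branches forces the branches to coincide).  No `IsGraph` hypothesis (open edges allowed), no commensurable
rigidity hypothesis.  Nothing here is about curves; no side is taken on [IUTchIII] Cor. 3.12.
-/

noncomputable section

open CategoryTheory Topology

namespace Literature.AnabelianGeometry.SemiGraphs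

namespace ProfiniteSemiGraph

universe u

variable {𝒢 : ProfiniteSemiGraph.{u}}

/-- If `y·ψ·y⁻¹ = φ` pointwise then `g·φ(A)·g⁻¹ = (g y)·ψ(A)·(g y)⁻¹` for every `A ≤ Π_v`. [folklore] -/
private theorem map_map_conj_eq_of_conj_eq {Γ Λ : Type u} [Group Γ] [Group Λ] [TopologicalSpace Γ]
    [TopologicalSpace Λ] (ψ φ : Γ →ₜ* Λ) (y : Λ) (hy : ∀ a, y * ψ a * y⁻¹ = φ a) (A : Subgroup Γ) (g : Λ) :
    (A.map φ.toMonoidHom).map (MulAut.conj g).toMonoidHom =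
      (A.map ψ.toMonoidHom).map (MulAut.conj (g * y)).toMonoidHom := by
  rw [Subgroup.map_map, Subgroup.map_map]
  congr 1
  ext a
  show g * φ a * g⁻¹ = g * y * ψ a * (g * y)⁻¹
  rw [← hy a, mul_inv_rev]
  group

/-- `⊤.map φ = range φ`, so `g·φ(Π_v)·g⁻¹ = (⊤.map φ).map γ_g`. [folklore] -/
private theorem range_map_eq_top_map_map {Γ Λ : Type u} [Group Γ] [Group Λ] [TopologicalSpace Γ]
    [TopologicalSpace Λ] (φ : Γ →ₜ* Λ) (g : Λ) :
    φ.toMonoidHom.range.map (MulAut.conj g).toMonoidHom =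
      ((⊤ : Subgroup Γ).map φ.toMonoidHom).map (MulAut.conj g).toMonoidHom := by
  rw [← MonoidHom.range_eq_map]

/-- **The verticial host of an edge-like subgroup through a given branch is unique** (family form).  Let `Φ` be
verticial homomorphisms at all vertices, `b` a branch of `e` abutting to `v`, and `g, g' ∈ π₁^temp(𝒢)` with
`g·Φ_v(Π_b)·g⁻¹ = g'·Φ_v(Π_b)·g'⁻¹ =: M`.  Then `g·Φ_v(Π_v)·g⁻¹ = g'·Φ_v(Π_v)·g'⁻¹`.  Proof: both are verticial hosts
of the nontrivial compact `M`; were they distinct, Thm. 3.7 (iii) at `𝒢` would put `M` inside an edge-like `L'` of a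
CLOSED edge `e'`, every host of `M` being one of the two; `e' = e` (edge-like subgroups of distinct edges have
infinite mutual index); presenting `L'` through the OTHER branch `b₂` of `e` exhibits a host `K₂` of `M` through `b₂`,
which must be one of the two hosts through `b` — and one host through two distinct branches is excluded by LEMMA E.
[cite: MochizukiSemiAnbd2006, Thm 3.7(iii) pp.40-41] -/
theorem host_eq_of_presentations_through_branch (hCV : CompactInVerticialAt 𝒢) (h𝒢 : 𝒢.Thm37Hypotheses)
    (c : TemperedPiChart 𝒢) (Φ : ∀ v : 𝒢.graph.Vertex, 𝒢.Gv v →ₜ* c.G) (hΦ : ∀ v, IsVerticialHom c v (Φ v))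
    {b : 𝒢.graph.Branch} {v : 𝒢.graph.Vertex} (hb : 𝒢.graph.abuts b = some v) (g g' : c.G)
    (hM : ((𝒢.branchSubgroup b v hb).map (Φ v).toMonoidHom).map (MulAut.conj g).toMonoidHom =
      ((𝒢.branchSubgroup b v hb).map (Φ v).toMonoidHom).map (MulAut.conj g').toMonoidHom) :
    (Φ v).toMonoidHom.range.map (MulAut.conj g).toMonoidHom =
      (Φ v).toMonoidHom.range.map (MulAut.conj g').toMonoidHom := by
  classical
  have hVD := verticialDistinct_holds.{u}
  have hVI := verticialInjective_holds.{u}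
  have hED : EdgeLikeDistinctAt 𝒢 := edgeLikeDistinctAt_of_compactInVerticialAt hCV
  haveI := TemperedPiChart.t2Space c
  set M := ((𝒢.branchSubgroup b v hb).map (Φ v).toMonoidHom).map (MulAut.conj g).toMonoidHom with hMdef
  set H := (Φ v).toMonoidHom.range.map (MulAut.conj g).toMonoidHom with hHdef
  set H' := (Φ v).toMonoidHom.range.map (MulAut.conj g').toMonoidHom with hH'def
  have hH : H ∈ verticialSubgroups c v :=
    conj_mem_verticialSubgroups c (range_mem_verticialSubgroups c (Φ v) (hΦ v)) g
  have hH' : H' ∈ verticialSubgroups c v :=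
    conj_mem_verticialSubgroups c (range_mem_verticialSubgroups c (Φ v) (hΦ v)) g'
  have hMe : M ∈ edgeLikeSubgroups c (𝒢.graph.edgeOf b) :=
    conj_mem_edgeLikeSubgroups' c (map_branchSubgroup_mem_edgeLikeSubgroups c b v hb (hΦ v)) g
  have hMH : M ≤ H := Subgroup.map_mono (Subgroup.map_le_range _ _)
  have hMH' : M ≤ H' := by rw [hM]; exact Subgroup.map_mono (Subgroup.map_le_range _ _)
  have hMc : IsCompact (M : Set c.G) := isCompact_of_mem_edgeLikeSubgroups c hMe
  haveI := infinite_of_mem_edgeLikeSubgroups hVI h𝒢 c hMe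
  have hMne : M ≠ ⊥ := fun h0 => by
    rw [h0] at this
    exact not_finite (⊥ : Subgroup c.G)
  by_contra hne
  obtain ⟨honly, e', L', he', hL', hML'⟩ := (hCV h𝒢 c M hMc).2 hMne v v H H' hH hH' hne hMH hMH'
  -- the closed edge is `e = edgeOf b`
  have hee : e' = 𝒢.graph.edgeOf b := by
    by_contra hee
    have h0 := hED h𝒢 c (𝒢.graph.edgeOf b) e' M L' hMe hL' (Ne.symm hee)
    rw [Subgroup.relIndex_eq_one.mpr hML'] at h0
    exact one_ne_zero h0
  subst hee
  -- the other branch `b₂` of `e`, at `w`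
  obtain ⟨b₁, b₂, u₁, u₂, h12, hb₁e, hb₂e, hb₁, hb₂⟩ := SemiGraph.exists_branches_of_isClosedEdge he'
  obtain ⟨bo, w, hbo, hboe, hbone⟩ : ∃ (bo : 𝒢.graph.Branch) (w : 𝒢.graph.Vertex),
      𝒢.graph.abuts bo = some w ∧ 𝒢.graph.edgeOf bo = 𝒢.graph.edgeOf b ∧ bo ≠ b := by
    by_cases hbb : b₁ = b
    · exact ⟨b₂, u₂, hb₂, hb₂e, fun h => h12 (hbb.trans h.symm)⟩
    · exact ⟨b₁, u₁, hb₁, hb₁e, hbb⟩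
  -- present `L'` through `bo`: its host `K₂` through `bo` contains `M`
  have hL'o : L' ∈ edgeLikeSubgroups c (𝒢.graph.edgeOf bo) := by rw [hboe]; exact hL'
  obtain ⟨x₂, hL'eq⟩ := edgeLike_eq_map_branchSubgroup c hbo hL'o (Φ w) (hΦ w)
  set K₂ := (Φ w).toMonoidHom.range.map (MulAut.conj x₂).toMonoidHom with hK₂def
  have hK₂ : K₂ ∈ verticialSubgroups c w :=
    conj_mem_verticialSubgroups c (range_mem_verticialSubgroups c (Φ w) (hΦ w)) x₂
  have hL'K₂ : L' ≤ K₂ := by rw [hL'eq]; exact Subgroup.map_mono (Subgroup.map_le_range _ _)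
  have hMbo : M ≤ ((𝒢.branchSubgroup bo w hbo).map (Φ w).toMonoidHom).map (MulAut.conj x₂).toMonoidHom := by
    rw [← hL'eq]; exact hML'
  -- `K₂` is one of the two hosts through `b`: either way LEMMA E forces `b = bo`
  rcases honly w K₂ hK₂ (hML'.trans hL'K₂) with hK | hK
  · exact hbone (branch_eq_of_hosts_eq hVD hVI h𝒢 c Φ hΦ hMne hb hbo g x₂ le_rfl hMbo (hHdef ▸ hK.symm)).symm
  · exact hbone (branch_eq_of_hosts_eq hVD hVI h𝒢 c Φ hΦ hMne hb hbo g' x₂ (hMdef.symm.trans hM).le hMbo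
      (hH'def ▸ hK.symm)).symm

/-- **The verticial host of an edge-like subgroup through a given branch is unique**, for any one verticial
homomorphism `φ` at the vertex `v` of the branch `b`: `g·φ(Π_b)·g⁻¹ = g'·φ(Π_b)·g'⁻¹` implies
`g·φ(Π_v)·g⁻¹ = g'·φ(Π_v)·g'⁻¹` (verticial homomorphisms at `v` are conjugate, Prop. 3.2).
[cite: MochizukiSemiAnbd2006, Thm 3.7(iii) pp.40-41] -/
theorem host_eq_of_presentations_through_branch' (hCV : CompactInVerticialAt 𝒢) (h𝒢 : 𝒢.Thm37Hypotheses)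
    (c : TemperedPiChart 𝒢) {b : 𝒢.graph.Branch} {v : 𝒢.graph.Vertex} (hb : 𝒢.graph.abuts b = some v)
    (φ : 𝒢.Gv v →ₜ* c.G) (hφ : IsVerticialHom c v φ) (g g' : c.G)
    (hM : ((𝒢.branchSubgroup b v hb).map φ.toMonoidHom).map (MulAut.conj g).toMonoidHom =
      ((𝒢.branchSubgroup b v hb).map φ.toMonoidHom).map (MulAut.conj g').toMonoidHom) :
    φ.toMonoidHom.range.map (MulAut.conj g).toMonoidHom =
      φ.toMonoidHom.range.map (MulAut.conj g').toMonoidHom := by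
  classical
  have hVI := verticialInjective_holds.{u}
  -- a family of verticial homomorphisms, and the conjugacy `φ = y·Φ_v·y⁻¹`
  have hΦ' : ∀ w : 𝒢.graph.Vertex, ∃ ψ : 𝒢.Gv w →ₜ* c.G, IsVerticialHom c w ψ := by
    intro w
    obtain ⟨K, ψ, hψ, -⟩ := (hVI 𝒢 h𝒢 c w).1
    exact ⟨ψ, hψ⟩
  choose Φ hΦ using hΦ'
  obtain ⟨iΦ⟩ := hΦ v
  obtain ⟨iφ⟩ := hφ
  obtain ⟨y, hy, -⟩ := BTemp.exists_conj_of_natTrans c.isTempered (Φ v) φ (iΦ.symm ≪≫ iφ).hom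
  have key := host_eq_of_presentations_through_branch hCV h𝒢 c Φ hΦ hb (g * y) (g' * y) (by
    rw [← map_map_conj_eq_of_conj_eq (Φ v) φ y hy, ← map_map_conj_eq_of_conj_eq (Φ v) φ y hy, hM])
  rw [range_map_eq_top_map_map, range_map_eq_top_map_map, map_map_conj_eq_of_conj_eq (Φ v) φ y hy,
    map_map_conj_eq_of_conj_eq (Φ v) φ y hy, ← range_map_eq_top_map_map, ← range_map_eq_top_map_map, key]

end ProfiniteSemiGraph

end Literature.AnabelianGeometry.SemiGraphs

end
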